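import Summits.BirchSwinnertonDyer.BirchSwinnertonDyer.Theorems.ClassRecordThreeRegCertKernelLog
import HarnessLib

/-!
# Route `ClassRecordThree`, crux `SchneiderAtThree` (item 19106): small shared lemmas of the second-order REG3CERT kernel
# evaluators (cell `bsd-stepL`, seat `bsd-stepL-reg3-eng` g3; `--supports stmt-BirchSwinnertonDyer-19106`)

HONEST FRAMING: BSD is not proved by any of this; pure `3`-adic arithmetic, no statement about any curve.
`three_dvd_pow_four_sub_one` (units of `ℤ/3`; the square version is `O5.FlexNormalForm.Isogenous.three_dvd_sq_sub_one`), and `norm_cubicPoly_sub_le`: the cubic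
`T + T²/2 + T³/3` (three terms of the Iwasawa series) is `1`-Lipschitz on `‖T‖₃ ≤ 3⁻¹`. Theorems only. [folklore]
-/

open scoped Classical

namespace Summit.BirchSwinnertonDyer.Rank1Residual.X11b.RegMult.KernelCert

/-- `‖(2 : ℚ₃)⁻¹‖ = 1`. [folklore] -/
private theorem norm_inv_two₅ : ‖(2 : ℚ_[3])⁻¹‖ = 1 := by
  rw [norm_inv, show (2 : ℚ_[3]) = ((2 : ℤ) : ℚ_[3]) by norm_cast, norm_intCast_eq_one_of_not_dvd (by decide),
    inv_one]

/-- `‖(3 : ℚ₃)⁻¹‖ = 3`. [folklore] -/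
private theorem norm_inv_three₅ : ‖(3 : ℚ_[3])⁻¹‖ = 3 := by
  rw [norm_inv, show (3 : ℚ_[3]) = ((3 : ℕ) : ℚ_[3]) by norm_cast, Padic.norm_p]; norm_num

/-- `3 ∤ n ⇒ 3 ∣ n⁴ − 1`. [folklore] -/
theorem three_dvd_pow_four_sub_one {n : ℤ} (h : ¬ (3 : ℤ) ∣ n) : (3 : ℤ) ∣ n ^ 4 - 1 := by
  have key : ∀ x : ZMod 3, x ≠ 0 → x ^ 4 - 1 = 0 := by decide
  have hx : ((n : ZMod 3)) ≠ 0 := by rw [Ne, ZMod.intCast_zmod_eq_zero_iff_dvd]; exact_mod_cast h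
  have h2 : (((n ^ 4 - 1 : ℤ)) : ZMod 3) = 0 := by push_cast; exact key _ hx
  exact_mod_cast (ZMod.intCast_zmod_eq_zero_iff_dvd _ 3).mp h2

/-- The cubic `T + T²/2 + T³/3` is `1`-Lipschitz on `‖T‖₃ ≤ 3⁻¹`. [folklore] -/
theorem norm_cubicPoly_sub_le {T T0 : ℚ_[3]} (hT : ‖T‖ ≤ 1 / 3) (hT0 : ‖T0‖ ≤ 1 / 3) :
    ‖(T + T ^ 2 / 2 + T ^ 3 / 3) - (T0 + T0 ^ 2 / 2 + T0 ^ 3 / 3)‖ ≤ ‖T - T0‖ := by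
  have hid : (T + T ^ 2 / 2 + T ^ 3 / 3) - (T0 + T0 ^ 2 / 2 + T0 ^ 3 / 3) =
      (T - T0) * (1 + (2 : ℚ_[3])⁻¹ * (T + T0) + (3 : ℚ_[3])⁻¹ * (T ^ 2 + T * T0 + T0 ^ 2)) := by
    have h2 : (2 : ℚ_[3]) ≠ 0 := by norm_num
    have h3 : (3 : ℚ_[3]) ≠ 0 := by norm_num
    field_simp; ring
  rw [hid, norm_mul]
  have hq : ‖T ^ 2 + T * T0 + T0 ^ 2‖ ≤ 1 / 9 := by
    refine (IsUltrametricDist.norm_add_le_max _ _).trans (max_le ?_ ?_)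
    · refine (IsUltrametricDist.norm_add_le_max _ _).trans (max_le ?_ ?_)
      · rw [norm_pow]; calc ‖T‖ ^ 2 ≤ (1 / 3) ^ 2 := by gcongr
          _ = 1 / 9 := by norm_num
      · rw [norm_mul]; calc ‖T‖ * ‖T0‖ ≤ 1 / 3 * (1 / 3) := by gcongr
          _ = 1 / 9 := by norm_num
    · rw [norm_pow]; calc ‖T0‖ ^ 2 ≤ (1 / 3) ^ 2 := by gcongr
        _ = 1 / 9 := by norm_num
  have hbr : ‖1 + (2 : ℚ_[3])⁻¹ * (T + T0) + (3 : ℚ_[3])⁻¹ * (T ^ 2 + T * T0 + T0 ^ 2)‖ ≤ 1 := by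
    refine (IsUltrametricDist.norm_add_le_max _ _).trans (max_le ?_ ?_)
    · refine (IsUltrametricDist.norm_add_le_max _ _).trans (max_le (by rw [norm_one]) ?_)
      rw [norm_mul, norm_inv_two₅, one_mul]
      exact ((IsUltrametricDist.norm_add_le_max _ _).trans (max_le hT hT0)).trans (by norm_num)
    · rw [norm_mul, norm_inv_three₅]
      calc 3 * ‖T ^ 2 + T * T0 + T0 ^ 2‖ ≤ 3 * (1 / 9) := by gcongr
        _ ≤ 1 := by norm_num
  calc ‖T - T0‖ * _ ≤ ‖T - T0‖ * 1 := by gcongr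
    _ = ‖T - T0‖ := mul_one _

end Summit.BirchSwinnertonDyer.Rank1Residual.X11b.RegMult.KernelCert
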